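import Literature.MathematicalPhysics.QuantumFieldTheory.Balaban1983to89.B13JointWalkExpansion

/-!
# Spine/NE5/TwoRunPencilWalks — row NE5's two-run W2 PENCIL in the walk-expansion OBJECT currency of row (D4)'s NODE O: the pencil
# through two runs' walk-TERM data consists of `JointWalkExpansion`s with constants ×`(1 + τ·r)` (cell `pub-balaban-gaps`, seat `ne5` gen 5)

WHY (row NE5, triage sheet `HOME/ne/NE5.md` §4 (M2), §7 (G-c) ∕ (r3) ∕ (r4)).  NE5's W2 wall asks the NODE-O builder for the
H-layer datum `hH` of `Spine/NE5/EnvelopeOnRecord.outputEnvelope_of_activities_record`: the step's activities holomorphic in the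
(operator, history) DATA with a data-UNIFORM (2.38)-majorant on a neighbourhood of the admissible two-margin box around each
run's data — i.e. [II] Lemma 3 re-proved «on the class» (1.5) p. 3 (*"we can replace the propagators by arbitrary operators
having the same regularity properties and satisfying the same bounds"*), residual (r3).  Since 2026-08-23 the (D4) planners
type the INPUT of Lemma 3's proof one layer below the activities, as ONE object per kernel family: g1-p2's
`B13JointWalkExpansion.JointWalkExpansion` (p349529 ✓; skeleton #6 of g1-plan-1) — entrywise `HasSum` over walks, termwise
analyticity in the configuration `u`, (1.11)∕(3.108)-shape per-term bounds `A_ω e^{−ρD_ω}`, reduced-rate `MajSumLe` by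
`K̄e^{−κd₁}`, the σ-structure (`indep`, `through`) — from which the landed chain `localisation17a_of_majorants` →
`h226_torus_of_two` → `hrep_of_termwise` → `bound238_torus_of_226` produces (2.38) with constants depending on the package
`(R, ε, κ, K̄, R_σ)` ONLY.  In THIS currency NE5's «class» question has a one-line answer, typed here:

* §1 `jointWalkExpansion_pencil` — two kernel families `K_A`, `K_B` (run A = spacing η read through the transport, run B =
  spacing η∕L, at the paired scale: SAME unit lattice, same walk skeleton `(W, SX, D, ρ)`, same σ-region `X`) that are joint
  walk expansions, whose TERMS are close in walk-weighted currency, `‖T_B ω σ u i j − T_A ω σ u i j‖ ≤ r·A_ω·e^{−ρD_ω(loc i, loc j)}`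
  (the two-run rate `r = r_j` delivered TERMWISE — King's *"difference of propagators on one line"*, CMP 102 p. 665, for a
  walk term = a finite product of local operators): then for every complex `t` with `‖t‖ ≤ τ` the pencil member
  `T_t := T_A + t·(T_B − T_A)` is a `JointWalkExpansion` of `K_t := K_A + t·(K_B − K_A)` with amplitudes `(1 + τr)·A_ω` and
  constant `(1 + τr)·K̄`, every other letter unchanged.  `walkMajorants_pencil`: the same for the covariance's weaker triple.
* §1b `jointWalkExpansion_scale` ∕ `_shift` + `jointWalkExpansion_pencil_dropped`: the honest junction form — closeness one
  rate drop `δ` weaker and ×`C ≥ 1` (what telescoping a product of local factors delivers) still gives the class, at rate `ρ − δ`.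
* §2 `jointWalkExpansion_pencil_reach` — with `τ := s ∕ r` the pencil reaches walk-weighted operator-distance `s` (NE5's box
  radius `rOp`, FIXED) from run A while the constants are `(1 + s)·A_ω`, `(1 + s)·K̄` — INDEPENDENT of the rate `r`; so as
  `r_j = θ^j → 0` the walk-expansion INPUTS of Lemma 3's proof for the Γ-kernel and the precision hold UNIFORMLY IN j AND t
  on NE5's pencils.  NOT supplied here: (a) the COVARIANCE `(A_t)⁻¹` of the precision pencil — not linear in `t`; its walk
  majorants need one resolvent ∕ Neumann step under a margin smallness `s·K̄_E·K̄_C·c ≲ 1` ([II] p. 13, p. 17 «α₅ sufficiently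
  small»); (b) the Gaussian-integral layer (2.23)–(2.25) and `act` as a FORMULA in its kernel arguments (NODE O).  The runs sit
  at `t = 0, 1` inside the disc `‖t‖ ≤ s∕r_j`; the E-layer Cauchy estimate (`Spine/NE5/EnvelopeFromActivities`) pays `r_j∕s`.
* §3 `jointWalkExpansion_pencilParam` — the interpolation parameter as ONE MORE CONFIGURATION COORDINATE: over `E × ℂ`
  the family `(u, t) ↦ K_A(σ,u) + (τ∕R)·t·(K_B(σ,u) − K_A(σ,u))` is a `JointWalkExpansion` on the `R`-ball (reference
  configuration `(0,0)` = run A at its base point), so g1-p2's projections `.analyticOnBall` (joint analyticity in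
  (background, interpolation)), `.majorants` ((1.7)-type bounds) and `.sub_ref_sigma` ((2.16) σ-part) hold uniformly on
  row (D4)'s seam ball × row NE5's pencil AT ONCE — the two rows' H-layer data are one object one layer down as well
  (cf. `Spine/NE5/StepObjectFromActivities`, the junction at the activity layer).
* §4 non-vacuity on constant kernels.
LOCATED JUNCTION FOR ROW NE2 (r4′, recorded in `ne/NE5.md` v5): the currency in which W1 must arrive for this to apply is
TERMWISE walk-weighted (`hdiff` below), one rate drop weaker than entrywise kernel currency (a term with `n` local factors
telescopes into `n` one-factor differences, `n ≲ 1 + D_ω` absorbed by `e^{−εD_ω}`); nothing is asked of ne2 here.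

HONEST FRAMING.  Bookkeeping by linearity over ONE LANDED hypothesis SHAPE (`B13JointWalkExpansion`, p349529); the two
families, their closeness `r`, the reach `s` and every constant are HYPOTHESES ∕ parameters; nothing of Bałaban's is
constructed or asserted (whether his `Γ_k(Z₀,σ,𝐔,𝐉)`, `Δ^{(k)}`, `C^{(k)}` at two spacings admit such data is NODE O,
instance 0∕1, + row NE2); NE5 NOT PRINTED ∕ NOT PROVED; (D4) NOT discharged; 0∕12 NE5 leaves on Bałaban's objects.  Rung
(B)+1 on a FIXED finite T⁴ — NOT continuum by itself, NOT infinite volume, NOT mass gap, NOT Clay.  Spine PROVED 0∕9.  HONEST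
DEPENDENCY: continuum YM on T⁴ ⇐ BetaPertH ∧ nine spine estimates; BetaPertH ⇐ (D1) ∧ (D4) ∧ CAP+tail.  0 sorry, 0 `def`, 0 new `Prop`.

Sources: [II] = T. Bałaban, CMP **116** (1988) 1–22 [Balaban1988RG2Cluster] (1.5) p. 3, (1.11) p. 5, p. 13, p. 15, (2.16)
p. 16, Lemma 3 (2.38) p. 20; [B9] = CMP **99** (1985) [Balaban1985BackgroundPropagators] Thm 3.10, (3.107)–(3.108) p. 416;
C. King, CMP **102** (1986) [King1986] p. 665.  Nothing here is a claim about the Yang–Mills mass gap.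
-/

noncomputable section

namespace Summit.QuantumFields.BalabanUV.T4Continuum.Spine.NE5.TwoRunPencilWalks

open Metric Set Matrix Finset
open Literature.MathematicalPhysics.QuantumFieldTheory.Balaban1983to89
open Literature.MathematicalPhysics.QuantumFieldTheory.Balaban1983to89.B9SectDWalk (Through MajSumLe)
open Literature.MathematicalPhysics.QuantumFieldTheory.Balaban1983to89.B9Thm34Ext (toB6)
open Literature.MathematicalPhysics.QuantumFieldTheory.Balaban1983to89.B9Thm37GlueTorus (torusGeom tdist1 tdist1_nonneg)
open Literature.MathematicalPhysics.QuantumFieldTheory.Balaban1983to89.TreeLengthTorus (TPt)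
open Literature.MathematicalPhysics.QuantumFieldTheory.Balaban1983to89.B5TorusCover (UT)
open Literature.MathematicalPhysics.QuantumFieldTheory.Balaban1983to89.B13JointWalkExpansion
  (JointWalkExpansion WalkMajorants jointWalkExpansion_const)

/-! ## §0. Two scalar helpers -/
section Helpers
/-- Scaling a majorant family and its bound by the same non-negative constant preserves `MajSumLe`. [folklore] -/
private theorem majSumLe_const_mul {g : B6.Geometry} {W : Type} {K : W → g.Site → g.Site → ℝ}
    {Kbar : g.Site → g.Site → ℝ} {C : ℝ} (hC : 0 ≤ C) (h : MajSumLe K Kbar) :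
    MajSumLe (fun ω a b => C * K ω a b) (fun a b => C * Kbar a b) := by
  intro S a b
  rw [← Finset.mul_sum]
  exact mul_le_mul_of_nonneg_left (h S a b) hC

/-- The pencil estimate on one entry: `‖a + t(b − a)‖ ≤ (1 + τr)·m` from `‖a‖ ≤ m`, `‖b − a‖ ≤ r·m`, `‖t‖ ≤ τ`. [folklore] -/
private theorem norm_add_mul_sub_le {a b t : ℂ} {m r τ : ℝ} (ha : ‖a‖ ≤ m) (hab : ‖b - a‖ ≤ r * m) (ht : ‖t‖ ≤ τ) :
    ‖a + t * (b - a)‖ ≤ (1 + τ * r) * m := by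
  have hτ : 0 ≤ τ := (norm_nonneg t).trans ht
  calc ‖a + t * (b - a)‖ ≤ ‖a‖ + ‖t * (b - a)‖ := norm_add_le _ _
    _ = ‖a‖ + ‖t‖ * ‖b - a‖ := by rw [norm_mul]
    _ ≤ m + τ * (r * m) := by gcongr
    _ = (1 + τ * r) * m := by ring

end Helpers
/-! ## §1. The pencil through two joint walk expansions with termwise-close terms -/
section Pencil

variable {d N' : ℕ} {ν : ℕ} {Nf : Fin ν → ℕ} [∀ i, NeZero (Nf i)]
variable {p n : Type}
variable {E : Type*} [NormedAddCommGroup E] [NormedSpace ℂ E]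
variable {c : B13.Consts} {locp : p → UT Nf} {locn : n → UT Nf}
variable {KA KB : (TPt d N' → ℂ) → E → Matrix p n ℂ}
variable {X : Finset (UT Nf)} {R ε kap Kbar RB εB kapB KbarB : ℝ}
variable {W : Type} {TA TB : W → (TPt d N' → ℂ) → E → Matrix p n ℂ} {SX : Set W} {A AB : W → ℝ}
variable {D : W → UT Nf → UT Nf → ℝ} {ρ ρB : ℝ}

/-- **THE TWO-RUN PENCIL IS IN THE CLASS.**  Two kernel families `K_A`, `K_B` on the same walk skeleton `(W, SX, D, ρ)` and
σ-region `X`, both joint walk expansions on σ-polydisc × `R`-ball (run B's own amplitudes `A^B_ω`, constant `K̄_B` are NOT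
used below — only its expansion identity, termwise analyticity and σ-structure), with TERMWISE-close terms in walk-weighted
currency `‖T_B ω σ u i j − T_A ω σ u i j‖ ≤ r·A_ω·e^{−ρD_ω(loc i, loc j)}` uniformly on polydisc × ball: then for every `t ∈ ℂ`,
`‖t‖ ≤ τ`, the pencil member `T_A + t·(T_B − T_A)` is a joint walk expansion of `K_A + t·(K_B − K_A)` with amplitudes
`(1 + τr)·A_ω` and constant `(1 + τr)·K̄` — same ball, drop, torus rate, σ-structure.  (Linearity of `HasSum`, of
differentiability and of the σ-identities; triangle inequality termwise; the partial-sum bound scales.)  This is the (1.5)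
class sentence *"operators … satisfying the same bounds"* for NE5's W2 pencil, in the object currency of row (D4)'s NODE O.
[cite: Balaban1988RG2Cluster, (1.5) p.3, (1.11) p.5, p.13, p.15; Balaban1985BackgroundPropagators, Thm 3.10 p.416] -/
theorem jointWalkExpansion_pencil
    (hA : JointWalkExpansion c locp locn KA X R ε kap Kbar TA SX A D ρ)
    (hB : JointWalkExpansion c locp locn KB X RB εB kapB KbarB TB SX AB D ρB) (hRB : R ≤ RB)
    {r τ : ℝ} (hr : 0 ≤ r) (hτ : 0 ≤ τ)
    (hdiff : ∀ ω, ∀ σ : TPt d N' → ℂ, (∀ j, ‖σ j‖ ≤ Real.exp c.κ₁) → ∀ u ∈ ball (0 : E) R,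
      ∀ i j, ‖TB ω σ u i j - TA ω σ u i j‖ ≤ r * (A ω * Real.exp (-(ρ * D ω (locp i) (locn j)))))
    {t : ℂ} (ht : ‖t‖ ≤ τ) :
    JointWalkExpansion c locp locn (fun σ u => KA σ u + t • (KB σ u - KA σ u)) X R ε kap ((1 + τ * r) * Kbar)
      (fun ω σ u => TA ω σ u + t • (TB ω σ u - TA ω σ u)) SX (fun ω => (1 + τ * r) * A ω) D ρ where
  hasSum σ hσ u hu i j := by
    simp only [Matrix.add_apply, Matrix.smul_apply, Matrix.sub_apply, smul_eq_mul]
    exact (hA.hasSum σ hσ u hu i j).add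
      (((hB.hasSum σ hσ u (ball_subset_ball hRB hu) i j).sub (hA.hasSum σ hσ u hu i j)).mul_left t)
  termAnalytic ω σ hσ i j := by
    simp only [Matrix.add_apply, Matrix.smul_apply, Matrix.sub_apply, smul_eq_mul]
    exact (hA.termAnalytic ω σ hσ i j).add
      ((((hB.termAnalytic ω σ hσ i j).mono (ball_subset_ball hRB)).sub (hA.termAnalytic ω σ hσ i j)).const_mul t)
  maj ω σ hσ u hu i j := by
    simp only [Matrix.add_apply, Matrix.smul_apply, Matrix.sub_apply, smul_eq_mul]
    rw [mul_assoc]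
    exact norm_add_mul_sub_le (hA.maj ω σ hσ u hu i j) (hdiff ω σ hσ u hu i j) ht
  majSum := by
    have h := majSumLe_const_mul (C := 1 + τ * r) (by positivity) hA.majSum
    intro S a b
    simpa only [mul_assoc] using h S a b
  indep ω hω σ hσ := by
    simp only [hA.indep ω hω σ hσ, hB.indep ω hω σ hσ]
  through := hA.through
  A_nonneg ω := mul_nonneg (by positivity) (hA.A_nonneg ω)
  D_nonneg := hA.D_nonneg

omit [NormedSpace ℂ E] in
/-- **The weaker triple along a pencil** (`WalkMajorants`: expansion + uniform per-term bounds + full-rate `MajSumLe`): same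
proof minus two fields.  CAVEAT: for Bałaban's covariance `C = A⁻¹` the object along NE5's precision pencil is `(A_t)⁻¹`, NOT
the pencil `C_A + t(C_B − C_A)` this lemma treats — that needs a resolvent ∕ Neumann step ([II] p. 13), not in this file.
[cite: Balaban1988RG2Cluster, p.13, p.15; Balaban1985BackgroundPropagators, (3.108) p.416] -/
theorem walkMajorants_pencil
    (hA : WalkMajorants c locp locn KA R kap Kbar TA A D ρ)
    (hB : WalkMajorants c locp locn KB RB kapB KbarB TB AB D ρB) (hRB : R ≤ RB)
    {r τ : ℝ} (hr : 0 ≤ r) (hτ : 0 ≤ τ)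
    (hdiff : ∀ ω, ∀ σ : TPt d N' → ℂ, (∀ j, ‖σ j‖ ≤ Real.exp c.κ₁) → ∀ u ∈ ball (0 : E) R,
      ∀ i j, ‖TB ω σ u i j - TA ω σ u i j‖ ≤ r * (A ω * Real.exp (-(ρ * D ω (locp i) (locn j)))))
    {t : ℂ} (ht : ‖t‖ ≤ τ) :
    WalkMajorants c locp locn (fun σ u => KA σ u + t • (KB σ u - KA σ u)) R kap ((1 + τ * r) * Kbar)
      (fun ω σ u => TA ω σ u + t • (TB ω σ u - TA ω σ u)) (fun ω => (1 + τ * r) * A ω) D ρ where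
  hasSum σ hσ u hu i j := by
    simp only [Matrix.add_apply, Matrix.smul_apply, Matrix.sub_apply, smul_eq_mul]
    exact (hA.hasSum σ hσ u hu i j).add
      (((hB.hasSum σ hσ u (ball_subset_ball hRB hu) i j).sub (hA.hasSum σ hσ u hu i j)).mul_left t)
  maj ω σ hσ u hu i j := by
    simp only [Matrix.add_apply, Matrix.smul_apply, Matrix.sub_apply, smul_eq_mul]
    rw [mul_assoc]
    exact norm_add_mul_sub_le (hA.maj ω σ hσ u hu i j) (hdiff ω σ hσ u hu i j) ht
  majSum := by
    have h := majSumLe_const_mul (C := 1 + τ * r) (by positivity) hA.majSum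
    intro S a b
    simpa only [mul_assoc] using h S a b
  A_nonneg ω := mul_nonneg (by positivity) (hA.A_nonneg ω)

/-! ### §1b. Two envelope steps and the pencil at a dropped rate (the termwise currency costs one rate drop) -/

/-- **Envelope step — amplitudes.**  Scaling every amplitude and the constant by the same `C ≥ 1` keeps a joint walk
expansion (per-term bounds weaken, partial sums scale). [cite: Balaban1985BackgroundPropagators, Thm 3.10 p.416] -/
theorem jointWalkExpansion_scale (h : JointWalkExpansion c locp locn KA X R ε kap Kbar TA SX A D ρ) {C : ℝ}
    (hC : 1 ≤ C) :
    JointWalkExpansion c locp locn KA X R ε kap (C * Kbar) TA SX (fun ω => C * A ω) D ρ where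
  hasSum := h.hasSum
  termAnalytic := h.termAnalytic
  maj ω σ hσ u hu i j := (h.maj ω σ hσ u hu i j).trans <| by
    rw [mul_assoc]
    exact le_mul_of_one_le_left (mul_nonneg (h.A_nonneg ω) (Real.exp_pos _).le) hC
  majSum := by
    have h' := majSumLe_const_mul (C := C) (by linarith) h.majSum
    intro S a b
    simpa only [mul_assoc] using h' S a b
  indep := h.indep
  through := h.through
  A_nonneg ω := mul_nonneg (by linarith) (h.A_nonneg ω)
  D_nonneg := h.D_nonneg

/-- **Envelope step — rate shift.**  Lowering the walk rate and the drop by the same `δ ≥ 0` keeps a joint walk expansion: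
the per-term bounds weaken (`D_ω ≥ 0`), the reduced rate `ρ − ε` — hence the `MajSumLe` field — is unchanged.
[cite: Balaban1985BackgroundPropagators, Thm 3.10 p.416] -/
theorem jointWalkExpansion_shift (h : JointWalkExpansion c locp locn KA X R ε kap Kbar TA SX A D ρ) {δ : ℝ}
    (hδ : 0 ≤ δ) :
    JointWalkExpansion c locp locn KA X R (ε - δ) kap Kbar TA SX A D (ρ - δ) where
  hasSum := h.hasSum
  termAnalytic := h.termAnalytic
  maj ω σ hσ u hu i j := (h.maj ω σ hσ u hu i j).trans <| mul_le_mul_of_nonneg_left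
    (Real.exp_le_exp.2 (by nlinarith [mul_nonneg hδ (h.D_nonneg ω (locp i) (locn j))])) (h.A_nonneg ω)
  majSum := by
    have e : ρ - δ - (ε - δ) = ρ - ε := by ring
    simpa only [e] using h.majSum
  indep := h.indep
  through := h.through
  A_nonneg := h.A_nonneg
  D_nonneg := h.D_nonneg

/-- **THE PENCIL AT A DROPPED RATE** (the honest form of the junction with row NE2): if the two runs' terms are close
only in the currency ONE RATE DROP `δ` weaker and a factor `C ≥ 1` larger than run A's per-term bounds —
`‖T_B ω − T_A ω‖ ≤ r·(C·A_ω)·e^{−(ρ−δ)D_ω}` (a walk term with `n ≲ 1 + D_ω` local factors telescopes into `n` one-factor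
differences; `(1 + D)e^{−δD} ≤ C`) — then the pencil members are joint walk expansions at walk rate `ρ − δ`, drop
`ε − δ`, amplitudes `(1 + τr)·C·A_ω`, constant `(1 + τr)·C·K̄`. [cite: Balaban1988RG2Cluster, (1.5) p.3, (1.11) p.5; King1986, p.665] -/
theorem jointWalkExpansion_pencil_dropped
    (hA : JointWalkExpansion c locp locn KA X R ε kap Kbar TA SX A D ρ)
    (hB : JointWalkExpansion c locp locn KB X RB εB kapB KbarB TB SX AB D ρB) (hRB : R ≤ RB)
    {r τ C δ : ℝ} (hr : 0 ≤ r) (hτ : 0 ≤ τ) (hC : 1 ≤ C) (hδ : 0 ≤ δ)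
    (hdiff : ∀ ω, ∀ σ : TPt d N' → ℂ, (∀ j, ‖σ j‖ ≤ Real.exp c.κ₁) → ∀ u ∈ ball (0 : E) R,
      ∀ i j, ‖TB ω σ u i j - TA ω σ u i j‖ ≤ r * (C * A ω * Real.exp (-((ρ - δ) * D ω (locp i) (locn j)))))
    {t : ℂ} (ht : ‖t‖ ≤ τ) :
    JointWalkExpansion c locp locn (fun σ u => KA σ u + t • (KB σ u - KA σ u)) X R (ε - δ) kap
      ((1 + τ * r) * (C * Kbar)) (fun ω σ u => TA ω σ u + t • (TB ω σ u - TA ω σ u)) SX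
      (fun ω => (1 + τ * r) * (C * A ω)) D (ρ - δ) :=
  jointWalkExpansion_pencil (jointWalkExpansion_shift (jointWalkExpansion_scale hA hC) hδ) hB hRB hr hτ hdiff ht

/-! ## §2. Reach `s` at rate-independent constants `(1 + s)` -/

/-- **REACH `s` WITH CONSTANTS `1 + s`, UNIFORMLY IN THE RATE.**  If the two runs' terms are `r`-close (`r > 0`) in
walk-weighted currency, the pencil member at any `t` with `‖t‖ ≤ s ∕ r` — walk-weighted operator-distance up to `s` from
run A — is a joint walk expansion with amplitudes `(1 + s)·A_ω` and constant `(1 + s)·K̄`.  For row NE5: `s := rOp` (the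
FIXED operator margin of the admissible box, [II] (2.16)–(2.17)) and `r := r_j` (the two-run rate of row NE2 at the paired
scale, `→ 0` geometrically): the Lemma-3 inputs hold on the whole pencil with a j-INDEPENDENT package while the parameter
disc `‖t‖ ≤ rOp ∕ r_j` containing both runs (`t = 0, 1`) GROWS — the E-layer Cauchy estimate then pays `r_j ∕ rOp`.
[cite: Balaban1988RG2Cluster, (1.5) p.3, (2.16) p.16; Balaban1985BackgroundPropagators, Thm 3.10 p.416] -/
theorem jointWalkExpansion_pencil_reach
    (hA : JointWalkExpansion c locp locn KA X R ε kap Kbar TA SX A D ρ)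
    (hB : JointWalkExpansion c locp locn KB X RB εB kapB KbarB TB SX AB D ρB) (hRB : R ≤ RB)
    {r s : ℝ} (hr : 0 < r) (hs : 0 ≤ s)
    (hdiff : ∀ ω, ∀ σ : TPt d N' → ℂ, (∀ j, ‖σ j‖ ≤ Real.exp c.κ₁) → ∀ u ∈ ball (0 : E) R,
      ∀ i j, ‖TB ω σ u i j - TA ω σ u i j‖ ≤ r * (A ω * Real.exp (-(ρ * D ω (locp i) (locn j)))))
    {t : ℂ} (ht : ‖t‖ ≤ s / r) :
    JointWalkExpansion c locp locn (fun σ u => KA σ u + t • (KB σ u - KA σ u)) X R ε kap ((1 + s) * Kbar)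
      (fun ω σ u => TA ω σ u + t • (TB ω σ u - TA ω σ u)) SX (fun ω => (1 + s) * A ω) D ρ := by
  have hsr : 1 + s / r * r = 1 + s := by rw [div_mul_cancel₀ s hr.ne']
  simpa only [hsr] using jointWalkExpansion_pencil hA hB hRB hr.le (div_nonneg hs hr.le) hdiff ht

omit [NormedSpace ℂ E] in
/-- The weaker triple: reach `s` with constants `1 + s` (same caveat). [cite: Balaban1985BackgroundPropagators, (3.108) p.416] -/
theorem walkMajorants_pencil_reach
    (hA : WalkMajorants c locp locn KA R kap Kbar TA A D ρ)
    (hB : WalkMajorants c locp locn KB RB kapB KbarB TB AB D ρB) (hRB : R ≤ RB)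
    {r s : ℝ} (hr : 0 < r) (hs : 0 ≤ s)
    (hdiff : ∀ ω, ∀ σ : TPt d N' → ℂ, (∀ j, ‖σ j‖ ≤ Real.exp c.κ₁) → ∀ u ∈ ball (0 : E) R,
      ∀ i j, ‖TB ω σ u i j - TA ω σ u i j‖ ≤ r * (A ω * Real.exp (-(ρ * D ω (locp i) (locn j)))))
    {t : ℂ} (ht : ‖t‖ ≤ s / r) :
    WalkMajorants c locp locn (fun σ u => KA σ u + t • (KB σ u - KA σ u)) R kap ((1 + s) * Kbar)
      (fun ω σ u => TA ω σ u + t • (TB ω σ u - TA ω σ u)) (fun ω => (1 + s) * A ω) D ρ := by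
  have h := walkMajorants_pencil hA hB hRB hr.le (div_nonneg hs hr.le) hdiff ht
  have hsr : 1 + s / r * r = 1 + s := by rw [div_mul_cancel₀ s hr.ne']
  simpa only [hsr] using h

/-- **Both runs lie in the parameter disc of the reach-`s` pencil** as soon as `r ≤ s` (the rate has dropped below the
margin: `‖0‖, ‖1‖ ≤ s ∕ r`). [folklore] -/
theorem runs_mem_reach_disc {r s : ℝ} (hr : 0 < r) (hrs : r ≤ s) :
    ‖(0 : ℂ)‖ ≤ s / r ∧ ‖(1 : ℂ)‖ ≤ s / r := by
  have h1 : (1 : ℝ) ≤ s / r := by rwa [le_div_iff₀ hr, one_mul]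
  exact ⟨by simpa using (zero_le_one.trans h1), by simpa using h1⟩

end Pencil

/-! ## §3. The interpolation parameter as one more configuration coordinate -/

section Param

variable {d N' : ℕ} {ν : ℕ} {Nf : Fin ν → ℕ} [∀ i, NeZero (Nf i)]
variable {p n : Type}
variable {E : Type*} [NormedAddCommGroup E] [NormedSpace ℂ E]
variable {c : B13.Consts} {locp : p → UT Nf} {locn : n → UT Nf}
variable {KA KB : (TPt d N' → ℂ) → E → Matrix p n ℂ}
variable {X : Finset (UT Nf)} {R ε kap Kbar RB εB kapB KbarB : ℝ}
variable {W : Type} {TA TB : W → (TPt d N' → ℂ) → E → Matrix p n ℂ} {SX : Set W} {A AB : W → ℝ}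
variable {D : W → UT Nf → UT Nf → ℝ} {ρ ρB : ℝ}

omit [NormedSpace ℂ E] in
/-- On the `R`-ball of `E × ℂ` (sup norm) the first coordinate is in the `R`-ball of `E`. [folklore] -/
private theorem fst_mem_ball {R : ℝ} {v : E × ℂ} (hv : v ∈ ball (0 : E × ℂ) R) : v.1 ∈ ball (0 : E) R := by
  rw [mem_ball_zero_iff] at hv ⊢
  exact (norm_fst_le v).trans_lt hv

omit [NormedSpace ℂ E] in
/-- On the `R`-ball of `E × ℂ` the rescaled second coordinate `(τ∕R)·t` has norm `≤ τ` (`τ ≥ 0`). [folklore] -/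
private theorem norm_scaled_snd_le {R τ : ℝ} (hτ : 0 ≤ τ) {v : E × ℂ} (hv : v ∈ ball (0 : E × ℂ) R) :
    ‖((τ / R : ℝ) : ℂ) * v.2‖ ≤ τ := by
  rw [mem_ball_zero_iff] at hv
  have hR : 0 < R := (norm_nonneg v).trans_lt hv
  have h2 : ‖v.2‖ ≤ R := ((norm_snd_le v).trans hv.le)
  rw [norm_mul, Complex.norm_real, Real.norm_of_nonneg (div_nonneg hτ hR.le)]
  calc τ / R * ‖v.2‖ ≤ τ / R * R := by gcongr
    _ = τ := div_mul_cancel₀ τ hR.ne'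

/-- **THE PENCIL PARAMETER AS A CONFIGURATION COORDINATE.**  Under the hypotheses of `jointWalkExpansion_pencil`, the
kernel family on the configuration space `E × ℂ`, `(u, t) ↦ K_A(σ,u) + (τ∕R)t·(K_B(σ,u) − K_A(σ,u))` (the factor `τ∕R`
makes the `R`-ball of the sup-normed product cover interpolation parameters up to `τ`), is a joint walk expansion on the
`R`-ball with amplitudes `(1 + τr)·A_ω`, constant `(1 + τr)·K̄`, terms `(u,t) ↦ T_A + (τ∕R)t·(T_B − T_A)`, and REFERENCE
configuration `(0, 0)` = run A at its base point (so the σ-structure is run A's).  Consequently g1-p2's projections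
apply to the (background, interpolation)-family at once: `.analyticOnBall` (JOINT analyticity in `(u, t)` — row (D4)'s seam
direction and row NE5's data direction together), `.majorants`, `.sub_ref_sigma`.
[cite: Balaban1988RG2Cluster, (1.5) p.3, p.15; Balaban1985BackgroundPropagators, Thm 3.10 p.416] -/
theorem jointWalkExpansion_pencilParam
    (hA : JointWalkExpansion c locp locn KA X R ε kap Kbar TA SX A D ρ)
    (hB : JointWalkExpansion c locp locn KB X RB εB kapB KbarB TB SX AB D ρB) (hRB : R ≤ RB)
    {r τ : ℝ} (hr : 0 ≤ r) (hτ : 0 ≤ τ)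
    (hdiff : ∀ ω, ∀ σ : TPt d N' → ℂ, (∀ j, ‖σ j‖ ≤ Real.exp c.κ₁) → ∀ u ∈ ball (0 : E) R,
      ∀ i j, ‖TB ω σ u i j - TA ω σ u i j‖ ≤ r * (A ω * Real.exp (-(ρ * D ω (locp i) (locn j))))) :
    JointWalkExpansion c locp locn
      (fun σ (v : E × ℂ) => KA σ v.1 + (((τ / R : ℝ) : ℂ) * v.2) • (KB σ v.1 - KA σ v.1)) X R ε kap
      ((1 + τ * r) * Kbar)
      (fun ω σ (v : E × ℂ) => TA ω σ v.1 + (((τ / R : ℝ) : ℂ) * v.2) • (TB ω σ v.1 - TA ω σ v.1)) SX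
      (fun ω => (1 + τ * r) * A ω) D ρ where
  hasSum σ hσ v hv i j := by
    have hu := fst_mem_ball hv
    simp only [Matrix.add_apply, Matrix.smul_apply, Matrix.sub_apply, smul_eq_mul]
    exact (hA.hasSum σ hσ _ hu i j).add
      (((hB.hasSum σ hσ _ (ball_subset_ball hRB hu) i j).sub (hA.hasSum σ hσ _ hu i j)).mul_left _)
  termAnalytic ω σ hσ i j := by
    simp only [Matrix.add_apply, Matrix.smul_apply, Matrix.sub_apply, smul_eq_mul]
    have hmaps : MapsTo (fun v : E × ℂ => v.1) (ball (0 : E × ℂ) R) (ball (0 : E) R) := fun v hv => fst_mem_ball hv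
    have hfst : DifferentiableOn ℂ (fun v : E × ℂ => v.1) (ball (0 : E × ℂ) R) := differentiableOn_fst
    have hTA : DifferentiableOn ℂ (fun v : E × ℂ => TA ω σ v.1 i j) (ball (0 : E × ℂ) R) :=
      (hA.termAnalytic ω σ hσ i j).comp hfst hmaps
    have hTB : DifferentiableOn ℂ (fun v : E × ℂ => TB ω σ v.1 i j) (ball (0 : E × ℂ) R) :=
      ((hB.termAnalytic ω σ hσ i j).mono (ball_subset_ball hRB)).comp hfst hmaps
    have ht : DifferentiableOn ℂ (fun v : E × ℂ => ((τ / R : ℝ) : ℂ) * v.2) (ball (0 : E × ℂ) R) :=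
      differentiableOn_snd.const_mul _
    exact hTA.add (ht.mul (hTB.sub hTA))
  maj ω σ hσ v hv i j := by
    simp only [Matrix.add_apply, Matrix.smul_apply, Matrix.sub_apply, smul_eq_mul]
    rw [mul_assoc (1 + τ * r)]
    have hu := fst_mem_ball hv
    exact norm_add_mul_sub_le (hA.maj ω σ hσ _ hu i j) (hdiff ω σ hσ _ hu i j) (norm_scaled_snd_le hτ hv)
  majSum := by
    have h := majSumLe_const_mul (C := 1 + τ * r) (by positivity) hA.majSum
    intro S a b
    simpa only [mul_assoc] using h S a b
  indep ω hω σ hσ := by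
    simp only [Prod.fst_zero, Prod.snd_zero, mul_zero, zero_smul, add_zero, hA.indep ω hω σ hσ]
  through := hA.through
  A_nonneg ω := mul_nonneg (by positivity) (hA.A_nonneg ω)
  D_nonneg := hA.D_nonneg

end Param

/-! ## §4. Non-vacuity: two constant kernels close in walk-weighted currency -/

section NonVacuity

variable {d N' : ℕ} {ν : ℕ} {Nf : Fin ν → ℕ} [∀ i, NeZero (Nf i)]
variable {p n : Type}
variable {E : Type*} [NormedAddCommGroup E] [NormedSpace ℂ E]

/-- The hypotheses of `jointWalkExpansion_pencil` are jointly inhabited: two CONSTANT kernel families `K₀`, `K₁` with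
`‖K₀‖ ≤ A₀e^{−ρD₀}` entrywise, `‖K₁ − K₀‖ ≤ r·A₀e^{−ρD₀}` entrywise (`0 ≤ r ≤ 1`, so `K₁` is bounded by `2A₀e^{−ρD₀}`), and a
`MajSumLe`-bounded one-term majorant give the two one-term expansions (`jointWalkExpansion_const`, `W = Unit`, `SX = ∅`) and
the termwise closeness — hence the whole pencil. Says nothing about Bałaban's kernels. [cite: Balaban1988RG2Cluster, (1.11) p.5] -/
theorem pencil_fires (c : B13.Consts) (locp : p → UT Nf) (locn : n → UT Nf) (K₀ K₁ : Matrix p n ℂ)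
    (X : Finset (UT Nf)) {R ε kap Kbar A₀ ρ r τ : ℝ} (hA₀ : 0 ≤ A₀) (hr : 0 ≤ r) (hr1 : r ≤ 1) (hτ : 0 ≤ τ)
    {D₀ : UT Nf → UT Nf → ℝ} (hD₀ : ∀ a b, 0 ≤ D₀ a b)
    (hmaj : ∀ i j, ‖K₀ i j‖ ≤ A₀ * Real.exp (-(ρ * D₀ (locp i) (locn j))))
    (hdiff : ∀ i j, ‖K₁ i j - K₀ i j‖ ≤ r * (A₀ * Real.exp (-(ρ * D₀ (locp i) (locn j)))))
    (hsum : MajSumLe (g := toB6 (torusGeom Nf 0 0 0) 0 True)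
      (fun (_ : Unit) a b => (2 * A₀) * Real.exp (-((ρ - ε) * D₀ a b))) (fun a b => Kbar * Real.exp (-(kap * tdist1 Nf a b))))
    {t : ℂ} (ht : ‖t‖ ≤ τ) :
    JointWalkExpansion c locp locn (fun (_ : TPt d N' → ℂ) (_ : E) => K₀ + t • (K₁ - K₀)) X R ε kap ((1 + τ * r) * Kbar)
      (fun (_ : Unit) (_ : TPt d N' → ℂ) (_ : E) => K₀ + t • (K₁ - K₀)) (∅ : Set Unit)
      (fun _ => (1 + τ * r) * A₀) (fun _ => D₀) ρ := by
  -- both constant families are one-term expansions with the common amplitude envelope `A₀` ∕ `2A₀`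
  have hsum₀ : MajSumLe (g := toB6 (torusGeom Nf 0 0 0) 0 True)
      (fun (_ : Unit) a b => A₀ * Real.exp (-((ρ - ε) * D₀ a b))) (fun a b => Kbar * Real.exp (-(kap * tdist1 Nf a b))) :=
    fun S a b => (Finset.sum_le_sum fun _ _ =>
      mul_le_mul_of_nonneg_right (by linarith) (Real.exp_pos _).le).trans (hsum S a b)
  have hmaj₁ : ∀ i j, ‖K₁ i j‖ ≤ (2 * A₀) * Real.exp (-(ρ * D₀ (locp i) (locn j))) := by
    intro i j
    have e0 : 0 ≤ A₀ * Real.exp (-(ρ * D₀ (locp i) (locn j))) := mul_nonneg hA₀ (Real.exp_pos _).le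
    calc ‖K₁ i j‖ = ‖K₀ i j + (K₁ i j - K₀ i j)‖ := by rw [add_sub_cancel]
      _ ≤ ‖K₀ i j‖ + ‖K₁ i j - K₀ i j‖ := norm_add_le _ _
      _ ≤ A₀ * Real.exp (-(ρ * D₀ (locp i) (locn j))) + r * (A₀ * Real.exp (-(ρ * D₀ (locp i) (locn j)))) :=
          add_le_add (hmaj i j) (hdiff i j)
      _ ≤ (2 * A₀) * Real.exp (-(ρ * D₀ (locp i) (locn j))) := by nlinarith
  have h0 := jointWalkExpansion_const (d := d) (N' := N') (E := E) c locp locn K₀ X (R := R) (ε := ε) (kap := kap)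
    hA₀ hD₀ hmaj hsum₀
  have h1 := jointWalkExpansion_const (d := d) (N' := N') (E := E) c locp locn K₁ X (R := R) (ε := ε) (kap := kap)
    (by linarith : 0 ≤ 2 * A₀) hD₀ hmaj₁ hsum
  exact jointWalkExpansion_pencil h0 h1 le_rfl hr hτ (fun _ σ _ u _ i j => hdiff i j) ht
end NonVacuity

end Summit.QuantumFields.BalabanUV.T4Continuum.Spine.NE5.TwoRunPencilWalks
end
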